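import Literature.NumberTheory.Automorphic.ParabolicInductionSupercuspidalProofs
import Literature.NumberTheory.Automorphic.UnipotentRadicalCompactOpenProofs
import Literature.NumberTheory.Automorphic.PAdicRepsSupercuspidalProofs
import Literature.NumberTheory.Automorphic.ParabolicInductionQuotientProofs
import Literature.NumberTheory.Automorphic.AdmissibleSubquotient
import Mathlib.RingTheory.FiniteLength
import Mathlib.Order.OrderIsoNat
import HarnessLib

/-!
# Finite length by counting Jacquet modules
(Bernstein–Zelevinsky 1977, §2.14 (2); Casselman 1995, proof of Cor. 6.3.7)

The **counting argument** by which Bernstein–Zelevinsky (1977, §2.14 (2): the additive function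
`l'(τ) = Σ_L l(r_{L,G}(τ))`, positive on every non-zero subquotient of `π`) and Casselman (1995,
proof of Cor. 6.3.7: "if one is given an ascending chain `I₁ ⊆ J₁ ⊆ I₂ ⊆ ⋯` … for any `Ω` one
has a corresponding chain of Jacquet modules … by 5.4.3 there would be some `Ω` for which the
chain of associated Jacquet modules is of infinite length, and this would be a contradiction. A
similar argument shows that the descending chain condition holds") deduce the finite length of
a parabolically induced representation from the finite length of its (finitely many) Jacquet
modules, isolated as a theorem about a smooth representation `I` of `GL_n(F)`:

> `Literature.NumberTheory.Automorphic.isFiniteLength_of_jacquetGL`: let `I` be a smooth complex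
> representation of `GL_n(F)` such that (a) for every proper standard parabolic `P_c` the
> Jacquet module `r_c I` has finite length over the group algebra of the Levi, and (b) `I` has
> no irreducible supercuspidal subquotient (no non-zero intertwining map from a subrepresentation
> of `I` to an irreducible admissible supercuspidal representation). Then `I` has finite length
> over `ℂ[GL_n(F)]`.

Hypothesis (b) holds for `I = i_c σ` with `P_c` proper and `σ` irreducible admissible
(Casselman's Cor. 5.4.3, `ParabolicIndGLNoSupercuspidalSubquotient`); hypothesis (a) for cuspidal
`σ` is the content of the Geometrical Lemma (Bernstein–Zelevinsky 1977, 2.12–2.13; Casselman 1995,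
Thm. 6.3.5). The present file is the glue between them and the named fact
`Representation.isFiniteLength_parabolicIndGL`.

## Proof

* (`wellFoundedGT_of_forall_lt`, `wellFoundedLT_of_forall_lt`, pure order theory) if finitely
  many monotone maps `Φᵢ : P → Qᵢ` into partial orders without infinite ascending (descending)
  chains jointly detect strict inequalities (`x < y ⇒ ∃ i, Φᵢ x < Φᵢ y`), then `P` has no
  infinite ascending (descending) chain: along a monotone sequence each `Φᵢ` is eventually
  constant, hence so is the sequence. Applied to the lattice of subrepresentations this gives
  `Representation.isFiniteLength_of_forall_lt_exists` (Noetherian ∧ Artinian ⇔ finite length).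
* `Φ_c N =` image of `N` in the Jacquet module `r_c I` (`jacquetImage`, an `M_c`-subrepresentation
  of `jacquetGL F c I`), monotone in `N`.
* (`exists_jacquetImage_lt`) If `N < N'` but `Φ_c N = Φ_c N'` for all proper `c`, pick
  `w₀ ∈ N' ∖ N`, `B = N + ⟨w₀⟩ ≤ N'`; the cyclic quotient `T = B / N` is smooth, finitely generated
  and — by the **left exactness** of the Jacquet functors (`jacquetMap_parabolicTripleGL_injective`,
  Bernstein–Zelevinsky 1977, Prop. 1.9 (a)) — all its proper Jacquet modules vanish; its quotient
  `ω` by a maximal proper subrepresentation is irreducible, smooth, with vanishing proper Jacquet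
  modules, hence supercuspidal by Harish-Chandra's criterion (`isSupercuspidal_iff_jacquetGL_holds`)
  and admissible (`IsSupercuspidal.isAdmissible_of_sigmaCompactSpace`), and `B → T → ω` is a
  non-zero intertwining map from a subrepresentation of `I` to `ω`, contradicting (b).

One auxiliary definition (`jacquetImage`); theorems otherwise; no named facts.

## References

* I. N. Bernstein, A. V. Zelevinsky, *Induced representations of reductive `p`-adic groups I*,
  Ann. Sci. ÉNS (4) 10 (1977), Prop. 1.9 (a), §2.14 (1)–(2), pp. 445, 449. [BernsteinZelevinsky1977]
* W. Casselman, *Introduction to the theory of admissible representations of `p`-adic reductive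
  groups* (draft 1 May 1995), proof of Cor. 6.3.7, pp. 59–60. [Casselman1995]
-/

noncomputable section

open scoped MatrixGroups MonoidAlgebra
open Function

/-! ### Order theory: finitely many monotone maps detecting strict inequalities -/

namespace Literature.NumberTheory.Automorphic.JacquetCounting

/-- If finitely many monotone maps `Φᵢ : P → Qᵢ` into partial orders satisfying the ascending
chain condition jointly detect strict inequalities, then `P` satisfies the ascending chain
condition: along a monotone sequence each `Φᵢ` stabilises, hence so does the sequence.
[folklore] -/
theorem wellFoundedGT_of_forall_lt {P : Type*} [PartialOrder P] {ι : Type*} [Finite ι]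
    {Q : ι → Type*} [∀ i, PartialOrder (Q i)] [∀ i, WellFoundedGT (Q i)]
    (Φ : ∀ i, P → Q i) (hΦ : ∀ i, Monotone (Φ i))
    (h : ∀ ⦃x y : P⦄, x < y → ∃ i, Φ i x < Φ i y) : WellFoundedGT P := by
  rw [wellFoundedGT_iff_monotone_chain_condition]
  intro a
  have hstab : ∀ i, ∃ N, ∀ m, N ≤ m → Φ i (a N) = Φ i (a m) := fun i =>
    WellFoundedGT.monotone_chain_condition
      (⟨fun m => Φ i (a m), fun m m' hmm' => hΦ i (a.mono hmm')⟩ : ℕ →o Q i)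
  choose N hN using hstab
  haveI := Fintype.ofFinite ι
  refine ⟨Finset.univ.sup N, fun m hm => ?_⟩
  by_contra hne
  obtain ⟨i, hi⟩ := h (lt_of_le_of_ne (a.mono hm) hne)
  have hle : N i ≤ Finset.univ.sup N := Finset.le_sup (Finset.mem_univ i)
  rw [← hN i _ hle, ← hN i m (hle.trans hm)] at hi
  exact lt_irrefl _ hi

/-- Dual form: finitely many monotone maps into partial orders satisfying the descending chain
condition which jointly detect strict inequalities force the descending chain condition.
[folklore] -/
theorem wellFoundedLT_of_forall_lt {P : Type*} [PartialOrder P] {ι : Type*} [Finite ι]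
    {Q : ι → Type*} [∀ i, PartialOrder (Q i)] [∀ i, WellFoundedLT (Q i)]
    (Φ : ∀ i, P → Q i) (hΦ : ∀ i, Monotone (Φ i))
    (h : ∀ ⦃x y : P⦄, x < y → ∃ i, Φ i x < Φ i y) : WellFoundedLT P := by
  have hgt : WellFoundedGT Pᵒᵈ :=
    wellFoundedGT_of_forall_lt (P := Pᵒᵈ) (Q := fun i => (Q i)ᵒᵈ)
      (fun i x => OrderDual.toDual (Φ i (OrderDual.ofDual x))) (fun i => (hΦ i).dual)
      (fun x y hxy => h (OrderDual.ofDual_lt_ofDual.2 hxy))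
  exact ⟨hgt.wf⟩

end Literature.NumberTheory.Automorphic.JacquetCounting

/-! ### Finite length of a representation from finitely many detecting monotone maps -/

namespace Representation

open Literature.NumberTheory.Automorphic.JacquetCounting

/-- **Finite length by counting.** If finitely many monotone maps from the subrepresentations of
`ρ` into partial orders with both chain conditions jointly detect strict inclusions, then
`ρ.asModule` has finite length over `k[G]` (finite length ⇔ Noetherian ∧ Artinian, and the
lattice of `k[G]`-submodules is that of subrepresentations). [folklore] -/
theorem isFiniteLength_of_forall_lt_exists {k G V : Type*} [Field k] [Group G] [AddCommGroup V]
    [Module k V] {ρ : Representation k G V} {ι : Type*} [Finite ι] {Q : ι → Type*}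
    [∀ i, PartialOrder (Q i)] [∀ i, WellFoundedGT (Q i)] [∀ i, WellFoundedLT (Q i)]
    (Φ : ∀ i, Subrepresentation ρ → Q i) (hΦ : ∀ i, Monotone (Φ i))
    (h : ∀ ⦃x y : Subrepresentation ρ⦄, x < y → ∃ i, Φ i x < Φ i y) :
    IsFiniteLength k[G] ρ.asModule := by
  let e := (Subrepresentation.subrepresentationSubmoduleOrderIso (ρ := ρ)).symm
  have hΦ' : ∀ i, Monotone (Φ i ∘ e) := fun i => (hΦ i).comp e.monotone
  have h' : ∀ ⦃x y : Submodule k[G] ρ.asModule⦄, x < y → ∃ i, (Φ i ∘ e) x < (Φ i ∘ e) y :=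
    fun x y hxy => h (e.strictMono hxy)
  rw [isFiniteLength_iff_isNoetherian_isArtinian, isNoetherian_iff']
  exact ⟨wellFoundedGT_of_forall_lt _ hΦ' h', wellFoundedLT_of_forall_lt _ hΦ' h'⟩

end Representation

/-! ### `GL_n(F)`: images in Jacquet modules -/

namespace Literature.NumberTheory.Automorphic

open Representation

section JacquetImage

variable {k : Type*} [CommRing k] {R : Type*} [CommRing R] {n : ℕ} {r : ℕ} (c : Fin n → Fin r)
  {V : Type*} [AddCommGroup V] [Module k V] (I : Representation k (GL (Fin n) R) V)

/-- **The image of a subrepresentation in the Jacquet module** `r_c I = V / V(U_c)`, as a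
subrepresentation of the Levi `Π_a GL_{n_a}` acting on `jacquetGL R c I` (the image of a `G`-stable
subspace under the `U_c`-coinvariant map is `M_c`-stable). [folklore] -/
def jacquetImage (N : Subrepresentation I) : Subrepresentation (jacquetGL R c I) where
  toSubmodule := N.toSubmodule.map (Coinvariants.mk (restrictUnipotentGL R c I))
  apply_mem_toSubmodule m x hx := by
    obtain ⟨v, hv, rfl⟩ := hx
    exact ⟨I (blockDiagonalGL R c m) v, N.apply_mem_toSubmodule _ hv, (jacquetGL_mk R c I m v).symm⟩

/-- Membership in the image: `x ∈ Φ_c N ↔ x = [v]` for some `v ∈ N`. [folklore] -/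
theorem mem_jacquetImage_iff (N : Subrepresentation I)
    (x : (restrictUnipotentGL R c I).Coinvariants) :
    x ∈ jacquetImage c I N ↔ ∃ v ∈ N, Coinvariants.mk (restrictUnipotentGL R c I) v = x :=
  Submodule.mem_map

/-- `N ↦ Φ_c N` is monotone. [folklore] -/
theorem jacquetImage_mono : Monotone (jacquetImage c I) := fun _ _ hNN' =>
  Submodule.map_mono (f := Coinvariants.mk (restrictUnipotentGL R c I)) hNN'

/-- The kernel `V(U_c)` maps into `W(U_c)` under any intertwining map `V → W`. [folklore] -/
theorem map_coinvariantsKer_le {W : Type*} [AddCommGroup W] [Module k W]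
    {J : Representation k (GL (Fin n) R) W} (f : I.IntertwiningMap J) :
    (Coinvariants.ker (restrictUnipotentGL R c I)).map f.toLinearMap ≤
      Coinvariants.ker (restrictUnipotentGL R c J) := by
  rw [Coinvariants.ker, Submodule.map_span_le]
  rintro _ ⟨⟨u, v⟩, rfl⟩
  have h : f.toLinearMap (restrictUnipotentGL R c I u v - v) =
      restrictUnipotentGL R c J u (f v) - f v := by
    rw [map_sub]
    exact congrArg (· - f v) (f.isIntertwining _ _ _ v)
  rw [h]
  exact Coinvariants.sub_mem_ker u (f v)

/-- The two presentations of `V(U_c)` agree (`restrictUnipotentGL` versus the abstract parabolic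
triple `parabolicTripleGL`; cf. `Representation.jacquetGLEquiv`). [folklore] -/
theorem coinvariantsKer_restrictUnipotentGL_eq (π : Representation k (GL (Fin n) R) V) :
    Coinvariants.ker (restrictUnipotentGL R c π) =
      Coinvariants.ker ((parabolicTripleGL R c).restrict π) := by
  change _ = Coinvariants.ker ((π.comp (standardParabolicGL R c).subtype).comp
    ((unipotentRadicalGL R c).subgroupOf (standardParabolicGL R c)).subtype)
  rw [unipotentRadicalGL_subgroupOf]

end JacquetImage

section LeftExact

variable {F : Type*} [Field F] [ValuativeRel F] [TopologicalSpace F] [IsNonarchimedeanLocalField F]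
  {n r : ℕ} (c : Fin n → Fin r) {V : Type*} [AddCommGroup V] [Module ℂ V]
  {I : Representation ℂ (GL (Fin n) F) V}

/-- **Left exactness of `r_c` in kernel form** (Bernstein–Zelevinsky 1977, Prop. 1.9 (a);
Casselman 1995, Prop. 3.2.3): for a subrepresentation `N` of a smooth `I` and monotone `c`,
`N ∩ V(U_c) = N(U_c)` — an element of `N` which dies in `r_c I` already dies in `r_c N`.
[cite: BernsteinZelevinsky1977, Prop. 1.9 (a)] -/
theorem mem_coinvariantsKer_toRepresentation (hI : I.IsSmooth) (hc : Monotone c)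
    (N : Subrepresentation I) {b : N.toSubmodule}
    (hb : (b : V) ∈ Coinvariants.ker (restrictUnipotentGL F c I)) :
    b ∈ Coinvariants.ker (restrictUnipotentGL F c N.toRepresentation) := by
  have hinj := jacquetMap_parabolicTripleGL_injective (F := F) c hc hI
    (Literature.RepresentationTheory.FiniteGroups.Subrepresentation.subtypeIntertwiningMap N)
    Subtype.val_injective
  have h0 : jacquetMap (parabolicTripleGL F c)
      (Literature.RepresentationTheory.FiniteGroups.Subrepresentation.subtypeIntertwiningMap N)
      (Coinvariants.mk _ b) = 0 := by
    rw [jacquetMap_mk, Coinvariants.mk_eq_zero, ← coinvariantsKer_restrictUnipotentGL_eq]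
    exact hb
  have h1 : Coinvariants.mk ((parabolicTripleGL F c).restrict N.toRepresentation) b = 0 :=
    hinj (by rw [h0, map_zero])
  rw [Coinvariants.mk_eq_zero, ← coinvariantsKer_restrictUnipotentGL_eq] at h1
  exact h1

end LeftExact

/-! ### The separation lemma and the criterion -/

section Criterion

universe v

variable {F : Type*} [Field F] [ValuativeRel F] [TopologicalSpace F] [IsNonarchimedeanLocalField F]
  {n : ℕ} {V : Type v} [AddCommGroup V] [Module ℂ V] {I : Representation ℂ (GL (Fin n) F) V}

omit [ValuativeRel F] [TopologicalSpace F] [IsNonarchimedeanLocalField F] in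
/-- A cyclic quotient is finitely generated: if `T = B / N` with `B = N + ⟨w₀⟩_G`, then the
`G`-orbit of `[w₀]` spans `T`. [folklore] -/
theorem span_orbit_mkQ_eq_top (N : Subrepresentation I) (w₀ : V)
    (NinB : Subrepresentation (N ⊔ I.orbitSpan w₀).toRepresentation)
    (hNinB : ∀ b : (N ⊔ I.orbitSpan w₀).toSubmodule, (b : V) ∈ N → b ∈ NinB)
    (hw₀ : w₀ ∈ N ⊔ I.orbitSpan w₀) :
    Submodule.span ℂ {x | ∃ g : GL (Fin n) F, ∃ y ∈ ({NinB.mkQ ⟨w₀, hw₀⟩} :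
      Set (((N ⊔ I.orbitSpan w₀).toSubmodule) ⧸ NinB.toSubmodule)),
        x = NinB.quotientRep g y} = ⊤ := by
  refine eq_top_iff.2 fun x _ => ?_
  obtain ⟨b, rfl⟩ := NinB.mkQ_surjective x
  have hb : (b : V) ∈ N.toSubmodule ⊔ (I.orbitSpan w₀).toSubmodule := b.2
  obtain ⟨a, ha, s, hs, hab⟩ := Submodule.mem_sup.1 hb
  obtain ⟨f, rfl⟩ := hs
  -- `b = a + Σ f_g ρ(g) w₀`, and `[a] = 0`
  have hsB : I.orbitCombination w₀ f ∈ N ⊔ I.orbitSpan w₀ :=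
    (le_sup_right : I.orbitSpan w₀ ≤ N ⊔ I.orbitSpan w₀) ⟨f, rfl⟩
  have haB : a ∈ N ⊔ I.orbitSpan w₀ := (le_sup_left : N ≤ N ⊔ I.orbitSpan w₀) ha
  have hbeq : b = ⟨a, haB⟩ + ⟨I.orbitCombination w₀ f, hsB⟩ := Subtype.ext hab.symm
  rw [hbeq, map_add, (NinB.mkQ_eq_zero_iff ⟨a, haB⟩).2 (hNinB ⟨a, haB⟩ ha), zero_add]
  -- induction on the finitely supported `f`
  clear hbeq hab
  revert hsB
  induction f using Finsupp.induction_linear with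
  | zero =>
    intro hsB
    have h0 : (⟨I.orbitCombination w₀ 0, hsB⟩ : (N ⊔ I.orbitSpan w₀).toSubmodule) = 0 :=
      Subtype.ext (map_zero _)
    rw [h0, map_zero]
    exact Submodule.zero_mem _
  | add f₁ f₂ h₁ h₂ =>
    intro hsB
    have h₁B : I.orbitCombination w₀ f₁ ∈ N ⊔ I.orbitSpan w₀ :=
      (le_sup_right : I.orbitSpan w₀ ≤ N ⊔ I.orbitSpan w₀) ⟨f₁, rfl⟩
    have h₂B : I.orbitCombination w₀ f₂ ∈ N ⊔ I.orbitSpan w₀ :=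
      (le_sup_right : I.orbitSpan w₀ ≤ N ⊔ I.orbitSpan w₀) ⟨f₂, rfl⟩
    have hadd : (⟨I.orbitCombination w₀ (f₁ + f₂), hsB⟩ : (N ⊔ I.orbitSpan w₀).toSubmodule) =
        ⟨I.orbitCombination w₀ f₁, h₁B⟩ + ⟨I.orbitCombination w₀ f₂, h₂B⟩ :=
      Subtype.ext (map_add _ _ _)
    rw [hadd, map_add]
    exact Submodule.add_mem _ (h₁ h₁B) (h₂ h₂B)
  | single g cg =>
    intro hsB
    have hgB : I g w₀ ∈ N ⊔ I.orbitSpan w₀ := (N ⊔ I.orbitSpan w₀).apply_mem_toSubmodule g hw₀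
    have hsingle : (⟨I.orbitCombination w₀ (Finsupp.single g cg), hsB⟩ :
        (N ⊔ I.orbitSpan w₀).toSubmodule) = cg • ⟨I g w₀, hgB⟩ :=
      Subtype.ext (by change I.orbitCombination w₀ (Finsupp.single g cg) = cg • I g w₀
                      rw [orbitCombination_single])
    rw [hsingle, map_smul]
    refine Submodule.smul_mem _ _ (Submodule.subset_span ⟨g, NinB.mkQ ⟨w₀, hw₀⟩, rfl, ?_⟩)
    rw [Subrepresentation.mkQ_apply, Subrepresentation.mkQ_apply, Subrepresentation.quotientRep_mk]
    rfl

/-- **The separation lemma** (Bernstein–Zelevinsky 1977, §2.14 (1); Casselman 1995, proof of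
Cor. 6.3.7): for a smooth `I` without irreducible supercuspidal subquotients, a strict inclusion
`N < N'` of subrepresentations is detected by some proper Jacquet module: `Φ_c N < Φ_c N'` for a
proper monotone `c`. Otherwise the cyclic quotient `(N + ⟨w₀⟩)/N`, `w₀ ∈ N' ∖ N`, has all proper
Jacquet modules zero (left exactness of `r_c`), hence an irreducible quotient which is
supercuspidal (Harish-Chandra's criterion) and admissible — a supercuspidal subquotient of `I`.
[cite: BernsteinZelevinsky1977, §2.14 (1)] -/
theorem exists_jacquetImage_lt (hI : I.IsSmooth)
    (hcusp : ∀ (N₀ : Subrepresentation I) (W : Type v) [AddCommGroup W] [Module ℂ W]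
      (τ : Representation ℂ (GL (Fin n) F) W) [τ.IsIrreducible], τ.IsAdmissible →
        τ.IsSupercuspidal → ∀ q : N₀.toRepresentation.IntertwiningMap τ, q = 0)
    {N N' : Subrepresentation I} (hlt : N < N') :
    ∃ (r : ℕ) (c : Fin n → Fin r), IsProperBlocks c ∧ Monotone c ∧
      jacquetImage c I N < jacquetImage c I N' := by
  classical
  by_contra hall
  push Not at hall
  have heq : ∀ (r : ℕ) (c : Fin n → Fin r), IsProperBlocks c → Monotone c →
      jacquetImage c I N = jacquetImage c I N' := fun r c hp hm =>
    (eq_or_lt_of_le (jacquetImage_mono c I hlt.le)).resolve_right (hall r c hp hm)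
  -- `w₀ ∈ N' \ N`, `B = N ⊔ ⟨w₀⟩ ≤ N'`, the cyclic quotient `T = B / N`
  obtain ⟨w₀, hw₀N', hw₀N⟩ := SetLike.exists_of_lt hlt
  set B : Subrepresentation I := N ⊔ I.orbitSpan w₀ with hBdef
  have hBN' : B ≤ N' := sup_le hlt.le (by
    rintro _ ⟨f, rfl⟩
    induction f using Finsupp.induction_linear with
    | zero => rw [map_zero]; exact N'.toSubmodule.zero_mem
    | add f₁ f₂ h₁ h₂ => rw [map_add]; exact N'.toSubmodule.add_mem h₁ h₂
    | single g cg =>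
      rw [orbitCombination_single]
      exact N'.toSubmodule.smul_mem _ (N'.apply_mem_toSubmodule g hw₀N'))
  have hw₀B : w₀ ∈ B := (le_sup_right : I.orbitSpan w₀ ≤ B) ⟨Finsupp.single 1 1, by simp⟩
  have heqB : ∀ (r : ℕ) (c : Fin n → Fin r), IsProperBlocks c → Monotone c →
      jacquetImage c I B = jacquetImage c I N := fun r c hp hm =>
    le_antisymm ((jacquetImage_mono c I hBN').trans (heq r c hp hm).symm.le)
      (jacquetImage_mono c I le_sup_left)
  let NinB : Subrepresentation B.toRepresentation :=
    ⟨N.toSubmodule.comap B.toSubmodule.subtype, fun g b hb => N.apply_mem_toSubmodule g hb⟩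
  have hNinB : ∀ b : B.toSubmodule, (b : V) ∈ N → b ∈ NinB := fun b hb => hb
  let T := NinB.quotientRep
  have hBs : B.toRepresentation.IsSmooth := hI.toRepresentation B
  have hTs : T.IsSmooth := hBs.quotientRep NinB
  set v₀ := NinB.mkQ ⟨w₀, hw₀B⟩ with hv₀def
  have hv₀ : v₀ ≠ 0 := fun h => hw₀N ((NinB.mkQ_eq_zero_iff _).1 h)
  -- `T` is finitely generated (cyclic) and non-zero: a maximal proper subrepresentation exists
  haveI : Module.Finite ℂ[GL (Fin n) F] T.asModule :=
    finite_asModule_of_span_orbit_eq_top T (Set.finite_singleton v₀)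
      (span_orbit_mkQ_eq_top N w₀ NinB hNinB hw₀B)
  haveI : Nontrivial (B.toSubmodule ⧸ NinB.toSubmodule) := ⟨⟨v₀, 0, hv₀⟩⟩
  obtain ⟨A, hA⟩ := exists_isCoatom_subrepresentation T
  haveI hωirr : A.quotientRep.IsIrreducible := Subrepresentation.isIrreducible_quotientRep hA
  have hωs : A.quotientRep.IsSmooth := hTs.quotientRep A
  -- all proper Jacquet modules of `T`, hence of `ω = T / A`, vanish
  have hkerT : ∀ (r : ℕ) (c : Fin n → Fin r), IsProperBlocks c → Monotone c →
      Coinvariants.ker (restrictUnipotentGL F c T) = ⊤ := by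
    intro r c hp hm
    refine eq_top_iff.2 fun x _ => ?_
    obtain ⟨b, rfl⟩ := NinB.mkQ_surjective x
    have hbimg : Coinvariants.mk (restrictUnipotentGL F c I) (b : V) ∈ jacquetImage c I B :=
      ⟨b, b.2, rfl⟩
    rw [heqB r c hp hm, mem_jacquetImage_iff] at hbimg
    obtain ⟨a, ha, hab⟩ := hbimg
    have haB : a ∈ B := (le_sup_left : N ≤ B) ha
    have hker : ((b - ⟨a, haB⟩ : B.toSubmodule) : V) ∈
        Coinvariants.ker (restrictUnipotentGL F c I) := by
      rw [← Coinvariants.mk_eq_zero, Submodule.coe_sub, map_sub, hab, sub_self]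
    have hkerB := mem_coinvariantsKer_toRepresentation c hI hm B hker
    have hx : NinB.mkQ b = NinB.mkQ (b - ⟨a, haB⟩) := by
      rw [map_sub, (NinB.mkQ_eq_zero_iff ⟨a, haB⟩).2 (hNinB ⟨a, haB⟩ ha), sub_zero]
    rw [hx]
    exact map_coinvariantsKer_le c (I := B.toRepresentation) NinB.mkQ ⟨_, hkerB, rfl⟩
  have hkerω : ∀ (r : ℕ) (c : Fin n → Fin r), IsProperBlocks c → Monotone c →
      Coinvariants.ker (restrictUnipotentGL F c A.quotientRep) = ⊤ := by
    intro r c hp hm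
    refine eq_top_iff.2 fun x _ => ?_
    obtain ⟨t, rfl⟩ := A.mkQ_surjective x
    have ht : t ∈ Coinvariants.ker (restrictUnipotentGL F c T) := by
      rw [hkerT r c hp hm]; trivial
    exact map_coinvariantsKer_le c (I := T) A.mkQ ⟨t, ht, rfl⟩
  -- `ω = T / A` is irreducible, smooth, supercuspidal (Harish-Chandra) and admissible
  have hωc : A.quotientRep.IsSupercuspidal :=
    ((isSupercuspidal_iff_jacquetGL_holds F (n := n)) A.quotientRep hωs).2 fun r c hp hm => by
      change Subsingleton (_ ⧸ Coinvariants.ker (restrictUnipotentGL F c A.quotientRep))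
      rw [hkerω r c hp hm]
      infer_instance
  haveI : SigmaCompactSpace (GL (Fin n) F) := sigmaCompactSpace_generalLinearGroup F n
  have hωa : A.quotientRep.IsAdmissible := IsSupercuspidal.isAdmissible_of_sigmaCompactSpace hωs hωc
  -- the non-zero map `B → T → ω` contradicts (b)
  have hq : (A.mkQ.comp NinB.mkQ) ⟨w₀, hw₀B⟩ ≠ 0 := by
    intro h0
    have hv₀A : v₀ ∈ A := (A.mkQ_eq_zero_iff _).1 h0
    apply hA.1
    refine eq_top_iff.2 fun x _ => ?_
    have hx : x ∈ Submodule.span ℂ {x | ∃ g : GL (Fin n) F, ∃ y ∈ ({v₀} :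
        Set (B.toSubmodule ⧸ NinB.toSubmodule)), x = T g y} := by
      rw [hv₀def, span_orbit_mkQ_eq_top N w₀ NinB hNinB hw₀B]; trivial
    refine (Submodule.span_le.2 ?_) hx
    rintro _ ⟨g, y, hy, rfl⟩
    rw [Set.mem_singleton_iff.1 hy]
    exact A.apply_mem_toSubmodule g hv₀A
  exact hq (by rw [hcusp B _ A.quotientRep hωa hωc (A.mkQ.comp NinB.mkQ)]; rfl)

/-- **Finite length by counting Jacquet modules** (Bernstein–Zelevinsky 1977, §2.14 (2);
Casselman 1995, proof of Cor. 6.3.7). Let `I` be a smooth complex representation of `GL_n(F)`,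
`F` a non-archimedean local field, such that

* (a) for every proper standard parabolic `P_c` (`c : Fin n → Fin r` monotone with
  `IsProperBlocks c`) the Jacquet module `r_c I` (`Representation.jacquetGL F c I`) has finite
  length over the group algebra of the Levi `Π_a GL_{n_a}(F)`, and
* (b) `I` has no irreducible supercuspidal subquotient: every intertwining map from a
  subrepresentation of `I` to an irreducible admissible supercuspidal representation is zero.

Then `I` has finite length over `ℂ[GL_n(F)]`: the finitely many monotone maps `N ↦ Φ_c N`
(image in `r_c I`) into lattices with both chain conditions detect every strict inclusion
(`exists_jacquetImage_lt`), so the lattice of subrepresentations of `I` has both chain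
conditions. [cite: BernsteinZelevinsky1977, §2.14 (2)] -/
theorem isFiniteLength_of_jacquetGL (hI : I.IsSmooth)
    (hfin : ∀ (r : ℕ) (c : Fin n → Fin r), IsProperBlocks c → Monotone c →
      IsFiniteLength ℂ[Π a, GL {i // c i = a} F] (jacquetGL F c I).asModule)
    (hcusp : ∀ (N₀ : Subrepresentation I) (W : Type v) [AddCommGroup W] [Module ℂ W]
      (τ : Representation ℂ (GL (Fin n) F) W) [τ.IsIrreducible], τ.IsAdmissible →
        τ.IsSupercuspidal → ∀ q : N₀.toRepresentation.IntertwiningMap τ, q = 0) :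
    IsFiniteLength ℂ[GL (Fin n) F] I.asModule := by
  classical
  let ι := Σ r : Fin (n + 1), {c : Fin n → Fin (r : ℕ) // IsProperBlocks c ∧ Monotone c}
  let Q : ι → Type _ := fun i => Subrepresentation (jacquetGL F i.2.1 I)
  haveI hGT : ∀ i : ι, WellFoundedGT (Q i) := fun i => by
    have h := hfin i.1 i.2.1 i.2.2.1 i.2.2.2
    rw [isFiniteLength_iff_isNoetherian_isArtinian, isNoetherian_iff'] at h
    haveI := h.1
    exact (Subrepresentation.subrepresentationSubmoduleOrderIso
      (ρ := jacquetGL F i.2.1 I)).strictMono.wellFoundedGT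
  haveI hLT : ∀ i : ι, WellFoundedLT (Q i) := fun i => by
    have h := hfin i.1 i.2.1 i.2.2.1 i.2.2.2
    rw [isFiniteLength_iff_isNoetherian_isArtinian] at h
    haveI : WellFoundedLT
        (Submodule ℂ[Π a, GL {j // i.2.1 j = a} F] (jacquetGL F i.2.1 I).asModule) := h.2
    exact (Subrepresentation.subrepresentationSubmoduleOrderIso
      (ρ := jacquetGL F i.2.1 I)).strictMono.wellFoundedLT
  refine isFiniteLength_of_forall_lt_exists (Q := Q) (fun i => jacquetImage i.2.1 I)
    (fun i => jacquetImage_mono i.2.1 I) ?_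
  intro N N' hlt
  obtain ⟨r, c, hp, hm, hlt'⟩ := exists_jacquetImage_lt hI hcusp hlt
  have hr : r < n + 1 := Nat.lt_succ_of_le (by
    simpa only [Fintype.card_fin] using Fintype.card_le_of_surjective c hp.1)
  exact ⟨⟨⟨r, hr⟩, c, hp, hm⟩, hlt'⟩

end Criterion

end Literature.NumberTheory.Automorphic
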